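import Mathlib
import HarnessLib
import Summits.AtomisticToContinuum.BoseEinsteinCondensation.Theorems.GapWindowLadderFreeWindowModes

/-!
# GapWindowLadder — the free-case door `GapWindowResponseFree` (stmt-AtomisticToContinuum-28031), part 2/4: CELLS

decomp-a2c lens-6 g14. This part: (5) Pythagoras along a unit vector in `L²` (`∫|u − ⟨v,u⟩v|² + |⟨v,u⟩|² = ∫|u|²`);
(6) Cauchy–Schwarz on the dyadic cells (`Σ_q ℓ⁻³ |∫_{Q_q} r|² ≤ ∫|r|²`); (7) the cell masses of the sine ground mode,
EXPLICITLY: `∫_{Q_q} s = ∏ᵢ √(2/L)(L/π)(cos(π qᵢ/2^m) − cos(π(qᵢ+1)/2^m))`, whence the coarse-grained mass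
`F_m(L) := ℓ⁻³ Σ_q |∫_{Q_q} s|² = (φ_m)³ =: F_m` is independent of `L`, with `F_m ≤ 1` and `F_0 = (8/π²)³`.
See part 1 (`GapWindowLadderFreeWindowModes`) for the whole argument.
-/

noncomputable section

namespace Summit.AtomisticToContinuum.BoseEinsteinCondensation.Theorems.GapWindowLadderFreeWindowCells

open scoped BigOperators Topology ENNReal NNReal ComplexConjugate
open Filter MeasureTheory Set
open Literature.MathematicalPhysics.QuantumManyBody.BoseGas
open Literature.MathematicalPhysics.QuantumManyBody.NeumannBox
open Literature.MathematicalPhysics.QuantumManyBody.DirichletBox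
open Summit.AtomisticToContinuum.BoseEinsteinCondensation.Theorems.GapWindowLadderFreeWindowModes

/-! ## 5. Pythagoras along the sine mode -/

section Pythagoras

/-- **Pythagoras for the projection onto a normalised vector** (`L²` of any measure space, `∫|u|² < ∞`,
`∫|v|² = 1`, `α = ∫ v̄u`): `∫|u − αv|² + |α|² = ∫|u|²`. [folklore] -/
theorem lintegral_sub_coef_mul_add {X : Type*} [MeasurableSpace X] {μ : Measure X}
    {u v : X → ℂ} (hu : AEStronglyMeasurable u μ) (hv : AEStronglyMeasurable v μ)
    (hu2' : ∫⁻ x, ‖u x‖ₑ ^ 2 ∂μ ≠ ⊤) (hv1 : ∫⁻ x, ‖v x‖ₑ ^ 2 ∂μ = 1) :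
    (∫⁻ x, ‖u x - (∫ y, conj (v y) * u y ∂μ) * v x‖ₑ ^ 2 ∂μ) + ‖∫ y, conj (v y) * u y ∂μ‖ₑ ^ 2 =
      ∫⁻ x, ‖u x‖ₑ ^ 2 ∂μ := by
  set α : ℂ := ∫ y, conj (v y) * u y ∂μ with hα
  have hu2 : Integrable (fun x => ‖u x‖ ^ 2) μ := integrable_norm_sq_of_lintegral hu hu2'
  have hv2 : Integrable (fun x => ‖v x‖ ^ 2) μ :=
    integrable_norm_sq_of_lintegral hv (by rw [hv1]; simp)
  have hcross : Integrable (fun x => conj (v x) * u x) μ := by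
    refine Integrable.mono' (hu2.add hv2) (by fun_prop) (ae_of_all _ fun x => ?_)
    rw [norm_mul, Complex.norm_conj]
    simp only [Pi.add_apply]
    nlinarith [sq_nonneg (‖v x‖ - ‖u x‖)]
  have hdiff : Integrable (fun x => ‖u x - α * v x‖ ^ 2) μ := by
    refine Integrable.mono' ((hu2.const_mul 2).add (hv2.const_mul (2 * ‖α‖ ^ 2))) (by fun_prop)
      (ae_of_all _ fun x => ?_)
    rw [Real.norm_of_nonneg (sq_nonneg _)]
    simp only [Pi.add_apply]
    have h1 : ‖u x - α * v x‖ ≤ ‖u x‖ + ‖α‖ * ‖v x‖ := by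
      calc ‖u x - α * v x‖ ≤ ‖u x‖ + ‖α * v x‖ := norm_sub_le _ _
        _ = ‖u x‖ + ‖α‖ * ‖v x‖ := by rw [norm_mul]
    have h0 : 0 ≤ ‖u x - α * v x‖ := norm_nonneg _
    nlinarith [sq_nonneg (‖u x‖ - ‖α‖ * ‖v x‖), norm_nonneg (u x), norm_nonneg α, norm_nonneg (v x),
      mul_nonneg (norm_nonneg α) (norm_nonneg (v x))]
  have hIv : ∫ x, ‖v x‖ ^ 2 ∂μ = 1 := by
    rw [integral_eq_lintegral_of_nonneg_ae (ae_of_all _ fun x => sq_nonneg _) (by fun_prop)]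
    simp_rw [← ofReal_norm, ← ENNReal.ofReal_pow (norm_nonneg _)] at hv1
    have : ∫⁻ x, ENNReal.ofReal (‖v x‖ ^ 2) ∂μ = 1 := hv1
    rw [this, ENNReal.toReal_one]
  have hIcross : ∫ x, (conj α * (conj (v x) * u x)).re ∂μ = ‖α‖ ^ 2 := by
    have h1 := Complex.reCLM.integral_comp_comm (hcross.const_mul (conj α))
    simp only [Complex.reCLM_apply] at h1
    rw [h1, MeasureTheory.integral_const_mul, ← hα, Complex.conj_mul', ← Complex.ofReal_pow,
      Complex.ofReal_re]
  have hre_int : Integrable (fun x => (conj α * (conj (v x) * u x)).re) μ := by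
    have h1 := Complex.reCLM.integrable_comp (hcross.const_mul (conj α))
    simpa only [Complex.reCLM_apply] using h1
  have hreal : ∫ x, ‖u x - α * v x‖ ^ 2 ∂μ = (∫ x, ‖u x‖ ^ 2 ∂μ) - ‖α‖ ^ 2 := by
    have hpt : (fun x => ‖u x - α * v x‖ ^ 2) =
        fun x => (‖u x‖ ^ 2 + ‖α‖ ^ 2 * ‖v x‖ ^ 2) - 2 * (conj α * (conj (v x) * u x)).re := by
      funext x; exact norm_sub_mul_sq (u x) (v x) α
    have hf1 : Integrable (fun x => ‖u x‖ ^ 2 + ‖α‖ ^ 2 * ‖v x‖ ^ 2) μ := hu2.add (hv2.const_mul _)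
    have hf2 : Integrable (fun x => 2 * (conj α * (conj (v x) * u x)).re) μ := hre_int.const_mul 2
    rw [hpt, integral_sub hf1 hf2, integral_add hu2 (hv2.const_mul _), MeasureTheory.integral_const_mul,
      MeasureTheory.integral_const_mul, hIv, hIcross]
    ring
  have hnn : 0 ≤ (∫ x, ‖u x‖ ^ 2 ∂μ) - ‖α‖ ^ 2 := by
    rw [← hreal]; exact integral_nonneg fun x => sq_nonneg _
  have hlin : ∫⁻ x, ‖u x - α * v x‖ₑ ^ 2 ∂μ = ENNReal.ofReal (∫ x, ‖u x - α * v x‖ ^ 2 ∂μ) := by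
    rw [ofReal_integral_eq_lintegral_ofReal hdiff (ae_of_all _ fun x => sq_nonneg _)]
    congr 1; funext x
    rw [← ofReal_norm, ENNReal.ofReal_pow (norm_nonneg _)]
  have hlinU : ∫⁻ x, ‖u x‖ₑ ^ 2 ∂μ = ENNReal.ofReal (∫ x, ‖u x‖ ^ 2 ∂μ) := by
    rw [ofReal_integral_eq_lintegral_ofReal hu2 (ae_of_all _ fun x => sq_nonneg _)]
    congr 1; funext x
    rw [← ofReal_norm, ENNReal.ofReal_pow (norm_nonneg _)]
  have hα2 : (‖α‖ₑ : ℝ≥0∞) ^ 2 = ENNReal.ofReal (‖α‖ ^ 2) := by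
    rw [← ofReal_norm, ENNReal.ofReal_pow (norm_nonneg _)]
  rw [hlin, hlinU, hreal, hα2, ← ENNReal.ofReal_add hnn (sq_nonneg _)]
  congr 1
  ring

end Pythagoras

/-! ## 6. Cauchy–Schwarz on the dyadic cells -/

section CellCS

variable {k : ℕ}

/-- Cauchy–Schwarz on a set: `|∫_Q r|² ≤ |Q| ∫_Q |r|²`. [folklore] -/
theorem enorm_setIntegral_sq_le {Q : Set Space} {r : Space → ℂ} (hr : AEStronglyMeasurable r volume) :
    ‖∫ x in Q, r x‖ₑ ^ 2 ≤ volume Q * ∫⁻ x in Q, ‖r x‖ₑ ^ 2 := by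
  have hf : AEMeasurable r (volume.restrict Q) := hr.aemeasurable.restrict
  calc ‖∫ x in Q, r x‖ₑ ^ 2 ≤ (∫⁻ x in Q, ‖r x‖ₑ) ^ 2 := by
        gcongr
        exact enorm_integral_le_lintegral_enorm _
    _ = (∫⁻ x in Q, 1 * ‖r x‖ₑ) ^ 2 := by simp only [one_mul]
    _ ≤ ((∫⁻ x in Q, (1 : ℝ≥0∞) ^ (2 : ℝ)) ^ (1 / (2 : ℝ)) *
          (∫⁻ x in Q, ‖r x‖ₑ ^ (2 : ℝ)) ^ (1 / (2 : ℝ))) ^ 2 := by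
        gcongr
        exact ENNReal.lintegral_mul_le_Lp_mul_Lq _ Real.HolderConjugate.two_two
          aemeasurable_const hf.enorm
    _ = volume Q * ∫⁻ x in Q, ‖r x‖ₑ ^ 2 := by
        rw [mul_pow, ← ENNReal.rpow_natCast, ← ENNReal.rpow_natCast, ← ENNReal.rpow_mul,
          ← ENNReal.rpow_mul]
        norm_num

/-- `ℓ⁻³ |∫_{Q_q} r|² ≤ ∫_{Q_q} |r|²`. -/
theorem inv_vol_mul_enorm_setIntegral_sq_le {ℓ : ℝ} (hℓ : 0 < ℓ) (q : SubIdx k) {r : Space → ℂ}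
    (hr : AEStronglyMeasurable r volume) :
    (ENNReal.ofReal ℓ ^ 3)⁻¹ * ‖∫ x in subCell ℓ q, r x‖ₑ ^ 2 ≤ ∫⁻ x in subCell ℓ q, ‖r x‖ₑ ^ 2 := by
  have h0 : ENNReal.ofReal ℓ ^ 3 ≠ 0 := pow_ne_zero _ (ENNReal.ofReal_pos.2 hℓ).ne'
  have htop : ENNReal.ofReal ℓ ^ 3 ≠ ⊤ := ENNReal.pow_ne_top ENNReal.ofReal_ne_top
  -- the sub-cell has volume `ℓ³` (a translate of `cell ℓ`)
  have hvol : volume (subCell ℓ q) = ENNReal.ofReal ℓ ^ 3 := by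
    have h : subCell ℓ q = (fun x : Space => x - subOffset ℓ q) ⁻¹' cell ℓ := rfl
    have h' : (fun x : Space => x - subOffset ℓ q) = fun x : Space => x + -subOffset ℓ q :=
      funext fun x => sub_eq_add_neg _ _
    rw [h, h', measure_preimage_add_right, volume_cell]
  calc (ENNReal.ofReal ℓ ^ 3)⁻¹ * ‖∫ x in subCell ℓ q, r x‖ₑ ^ 2
      ≤ (ENNReal.ofReal ℓ ^ 3)⁻¹ * (volume (subCell ℓ q) * ∫⁻ x in subCell ℓ q, ‖r x‖ₑ ^ 2) := by
        gcongr; exact enorm_setIntegral_sq_le hr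
    _ = ∫⁻ x in subCell ℓ q, ‖r x‖ₑ ^ 2 := by
        rw [hvol, ← mul_assoc, ENNReal.inv_mul_cancel h0 htop, one_mul]

/-- `∑_q ℓ⁻³ |∫_{Q_q} r|² ≤ ∫ |r|²` (Bessel for the piecewise-constant modes). -/
theorem sum_inv_vol_mul_enorm_setIntegral_sq_le {ℓ : ℝ} (hℓ : 0 < ℓ) {r : Space → ℂ}
    (hr : AEStronglyMeasurable r volume) :
    ∑ q : SubIdx k, (ENNReal.ofReal ℓ ^ 3)⁻¹ * ‖∫ x in subCell ℓ q, r x‖ₑ ^ 2 ≤ ∫⁻ x, ‖r x‖ₑ ^ 2 :=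
  (Finset.sum_le_sum fun q _ => inv_vol_mul_enorm_setIntegral_sq_le hℓ q hr).trans
    (sum_setLIntegral_subCell_le hℓ (hr.enorm.pow_const _))

end CellCS

/-! ## 7. The cell masses of the sine mode, explicitly -/

section SineCellMass


/-- `∫_a^b σ_L = (2/L)^{1/2}(L/π)(cos(πa/L) − cos(πb/L))`. -/
theorem integral_sigma1 {L : ℝ} (hL : 0 < L) (a b : ℝ) :
    ∫ t in a..b, sigma1 L t =
      Real.sqrt (2 / L) * (L / Real.pi) * (Real.cos (Real.pi * a / L) - Real.cos (Real.pi * b / L)) := by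
  have hπ := Real.pi_pos
  have hderiv : ∀ t ∈ Set.uIcc a b,
      HasDerivAt (fun t => Real.sqrt (2 / L) * (-(L / Real.pi) * Real.cos (Real.pi * t / L)))
        (sigma1 L t) t := by
    intro t _
    have h1 : HasDerivAt (fun t => Real.pi * t / L) (Real.pi / L) t := by
      have := ((hasDerivAt_id t).const_mul Real.pi).div_const L
      simpa using this
    have h2 := h1.cos
    have h3 := (h2.const_mul (-(L / Real.pi))).const_mul (Real.sqrt (2 / L))
    refine h3.congr_deriv ?_
    unfold sigma1
    field_simp
  rw [intervalIntegral.integral_eq_sub_of_hasDerivAt hderiv ((continuous_sigma1 L).intervalIntegrable _ _)]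
  ring

/-- the 1-D cell integrals of `σ_L` at level `m`. -/
theorem setIntegral_Ico_sigma1 {L : ℝ} (hL : 0 < L) (m j : ℕ) :
    ∫ t in Set.Ico (L / 2 ^ m * j) (L / 2 ^ m * j + L / 2 ^ m), sigma1 L t =
      Real.sqrt (2 / L) * (L / Real.pi) * dcos m j := by
  have hℓ : 0 < L / 2 ^ m := by positivity
  have hA : Real.pi * (L / 2 ^ m * j) / L = Real.pi * j / 2 ^ m := by
    rw [div_eq_iff hL.ne']; ring
  have hB : Real.pi * (L / 2 ^ m * j + L / 2 ^ m) / L = Real.pi * (j + 1) / 2 ^ m := by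
    rw [div_eq_iff hL.ne']; ring
  rw [integral_Ico_eq_integral_Ioc, ← intervalIntegral.integral_of_le (by linarith),
    integral_sigma1 hL, hA, hB, dcos]

/-- sub-cells in coordinates. -/
theorem subCell_eq_preimage {k : ℕ} (ℓ : ℝ) (q : SubIdx k) :
    subCell ℓ q = (MeasurableEquiv.toLp 2 (Fin 3 → ℝ)).symm ⁻¹'
      (Set.pi univ fun i : Fin 3 => Ico (ℓ * ((q i : ℕ) : ℝ)) (ℓ * ((q i : ℕ) : ℝ) + ℓ)) := by
  ext x; simp [mem_subCell, MeasurableEquiv.coe_toLp_symm]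

/-- set integrals over a sub-cell in coordinates. -/
theorem setIntegral_subCell_eq {k : ℕ} (ℓ : ℝ) (q : SubIdx k) (F : Space → ℂ) :
    ∫ x in subCell ℓ q, F x =
      ∫ y in Set.pi univ fun i : Fin 3 => Ico (ℓ * ((q i : ℕ) : ℝ)) (ℓ * ((q i : ℕ) : ℝ) + ℓ),
        F (WithLp.toLp 2 y) := by
  have hmp : MeasurePreserving (MeasurableEquiv.toLp 2 (Fin 3 → ℝ)).symm volume volume :=
    EuclideanSpace.volume_preserving_symm_measurableEquiv_toLp (Fin 3)
  have h1 : (fun x : Space => F x) = fun x =>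
      (fun y : Fin 3 → ℝ => F (WithLp.toLp 2 y)) ((MeasurableEquiv.toLp 2 (Fin 3 → ℝ)).symm x) := by
    funext x; simp
  rw [h1, subCell_eq_preimage,
    hmp.setIntegral_preimage_emb (MeasurableEquiv.measurableEmbedding _)
      (fun y : Fin 3 → ℝ => F (WithLp.toLp 2 y)) _]

/-- the sine mode is integrable. -/
theorem integrable_sineMode (L : ℝ) : Integrable (sineMode L) := by
  have hbox : volume (box L) ≠ ⊤ := by
    refine ne_top_of_le_ne_top (b := volume (cell L)) (by rw [volume_cell]; exact ENNReal.pow_ne_top ENNReal.ofReal_ne_top)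
      (measure_mono fun x hx i => Set.Ioo_subset_Ico_self (hx i))
  have h : IntegrableOn (fun x : Space => ((∏ i : Fin 3, sigma1 L (x i) : ℝ) : ℂ)) (box L) volume := by
    refine Measure.integrableOn_of_bounded (M := Real.sqrt (2 / L) ^ 3) hbox
      (continuous_prodSigma L).aestronglyMeasurable (ae_of_all _ fun x => ?_)
    have := norm_sineMode_le (L := L) x
    by_cases hx : x ∈ box L
    · rwa [sineMode_of_mem hx] at this
    · rw [Complex.norm_real, Real.norm_eq_abs, Finset.abs_prod]
      calc ∏ i : Fin 3, |sigma1 L (x i)| ≤ ∏ _i : Fin 3, Real.sqrt (2 / L) := by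
            refine Finset.prod_le_prod (fun i _ => abs_nonneg _) fun i _ => ?_
            unfold sigma1
            rw [abs_mul, abs_of_nonneg (Real.sqrt_nonneg _)]
            exact mul_le_of_le_one_right (Real.sqrt_nonneg _) (Real.abs_sin_le_one _)
        _ = Real.sqrt (2 / L) ^ 3 := by rw [Finset.prod_const, Finset.card_univ, Fintype.card_fin]
  have h2 := (integrable_indicator_iff (measurableSet_box L)).2 h
  exact h2

/-- **The cell masses of the sine mode**: `a_q = ∏ᵢ (2/L)^{1/2}(L/π) Δcos_m(qᵢ)`. -/
theorem cellMass_eq {L : ℝ} (hL : 0 < L) (m : ℕ) (q : SubIdx (2 ^ m)) :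
    cellMass L m q = ((∏ i : Fin 3, Real.sqrt (2 / L) * (L / Real.pi) * dcos m (q i) : ℝ) : ℂ) := by
  have hℓ : 0 < L / 2 ^ m := by positivity
  have hkℓ : ((2 ^ m : ℕ) : ℝ) * (L / 2 ^ m) = L := by push_cast; field_simp
  have h1 : cellMass L m q = ∫ x in subCell (L / 2 ^ m) q, ((∏ i : Fin 3, sigma1 L (x i) : ℝ) : ℂ) := by
    unfold cellMass
    refine setIntegral_congr_fun (measurableSet_subCell _ q) fun x hx => ?_
    have hx' : x ∈ cell L := by
      have := subCell_subset_cell hℓ q hx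
      rwa [hkℓ] at this
    exact sineMode_of_mem_cell hx'
  rw [h1, setIntegral_subCell_eq]
  dsimp only
  rw [volume_pi, Measure.restrict_pi_pi]
  simp_rw [Complex.ofReal_prod]
  rw [integral_fintype_prod_eq_prod (𝕜 := ℂ) (fun (i : Fin 3) (t : ℝ) => ((sigma1 L t : ℝ) : ℂ))]
  refine Finset.prod_congr rfl fun i _ => ?_
  rw [integral_complex_ofReal, ← setIntegral_Ico_sigma1 hL m (q i)]


/-- **`F_m(L) = F_m` is explicit and independent of `L`.** -/
theorem Freal_eq {L : ℝ} (hL : 0 < L) (m : ℕ) : Freal L m = Fexp m := by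
  have hπ := Real.pi_pos
  unfold Freal Fexp
  have h1 : ∀ q : SubIdx (2 ^ m), ((L / 2 ^ m) ^ 3)⁻¹ * ‖cellMass L m q‖ ^ 2 =
      ∏ i : Fin 3, 2 ^ (m + 1) / Real.pi ^ 2 * dcos m (q i) ^ 2 := by
    intro q
    rw [cellMass_eq hL, Complex.norm_real, Real.norm_eq_abs, sq_abs, ← Finset.prod_pow]
    have h3 : ((L / 2 ^ m) ^ 3)⁻¹ = ∏ _i : Fin 3, 2 ^ m / L := by
      rw [Finset.prod_const, Finset.card_univ, Fintype.card_fin]; field_simp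
    rw [h3, ← Finset.prod_mul_distrib]
    refine Finset.prod_congr rfl fun i _ => ?_
    rw [mul_pow, mul_pow, Real.sq_sqrt (by positivity)]
    field_simp
    ring
  rw [Finset.mul_sum]
  simp_rw [h1]
  rw [← Fintype.prod_sum (fun (_ : Fin 3) (j : Fin (2 ^ m)) => 2 ^ (m + 1) / Real.pi ^ 2 * dcos m j ^ 2),
    Finset.prod_const, Finset.card_univ, Fintype.card_fin, sinePhi,
    ← Fin.sum_univ_eq_sum_range (fun j => 2 ^ (m + 1) / Real.pi ^ 2 * dcos m j ^ 2)]

/-- Bessel: `F_m(L) ≤ ‖s_L‖² = 1`. -/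
theorem Freal_le_one {L : ℝ} (hL : 0 < L) (m : ℕ) : Freal L m ≤ 1 := by
  have hℓ : 0 < L / 2 ^ m := by positivity
  have key := sum_inv_vol_mul_enorm_setIntegral_sq_le (k := 2 ^ m) hℓ (aestronglyMeasurable_sineMode L)
  rw [lintegral_sineMode_sq hL] at key
  have h1 : ENNReal.ofReal (Freal L m) =
      ∑ q : SubIdx (2 ^ m), (ENNReal.ofReal (L / 2 ^ m) ^ 3)⁻¹ * ‖∫ x in subCell (L / 2 ^ m) q, sineMode L x‖ₑ ^ 2 := by
    unfold Freal
    rw [ENNReal.ofReal_mul (by positivity), ENNReal.ofReal_sum_of_nonneg (fun q _ => sq_nonneg _),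
      Finset.mul_sum]
    refine Finset.sum_congr rfl fun q _ => ?_
    rw [ENNReal.ofReal_inv_of_pos (by positivity), ENNReal.ofReal_pow hℓ.le, ← ofReal_norm,
      ← ENNReal.ofReal_pow (norm_nonneg _)]
    rfl
  rw [← h1] at key
  exact ENNReal.ofReal_le_one.1 key

/-- `F_m ≤ 1`. -/
theorem Fexp_le_one (m : ℕ) : Fexp m ≤ 1 := by
  rw [← Freal_eq one_pos m]; exact Freal_le_one one_pos m

/-- `F_0 = (8/π²)³`. -/
theorem Fexp_zero : Fexp 0 = (8 / Real.pi ^ 2) ^ 3 := by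
  simp only [Fexp, sinePhi, dcos, pow_zero, Finset.range_one, Finset.sum_singleton, Nat.cast_zero,
    mul_zero, Real.cos_zero, zero_add, mul_one, div_one, Real.cos_pi, pow_one]
  ring

end SineCellMass

end Summit.AtomisticToContinuum.BoseEinsteinCondensation.Theorems.GapWindowLadderFreeWindowCells
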